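import Mathlib
import Summits.Ventures.PercRepro2.TypedPocketABSupport
import Summits.Ventures.PercRepro2.TypedPocketA1BStates

/-!
# The `{a₁, b}`-pocket class (HARRIS-1), III: the split and the states of the support (blind cell
PercRepro2, p3 g8, 2026-08-26; `proofs/P3-HARRIS.md` §2)

`SplitH`: the doors `a₁, b` separate the o-side `WO ∋ o` from the far side `WB ∋ a₂, a₃` (every
open edge of the support within one side, the sides meeting only in the doors, no typed edge within
both).  The far-side state is `SepThree.bSt`; the o-side state is `PocketAB.oStP` with `a₁` in the
role of the door `a₃` (it records `a₁~o`, `b~o`, `a₁~b` inside the pocket).  The two-door closure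
lemmas give the seven coordinates and `st_eq_harrisSt`.  Own work; standard axioms.
-/

namespace Summit.Ventures.PercRepro2

open UnionCluster

namespace CovForm

namespace PocketA1B

open OneTyped TypedA3 Untouched TypedFactor Separated RootBridge SepThree

section Support

open Classical

variable {V : Type*} {E : Type*} [Fintype E] [DecidableEq E]
variable (ends : E → Sym2 V) (o a₁ a₂ a₃ b : V)

/-- **The `{a₁, b}`-pocket split**: the doors `a₁, b` separate the o-side `WO ∋ o` from the far
side `WB ∋ a₂, a₃` in the support `z ∪ F`. -/
structure SplitH (WO WB : Set V) (F : Finset E) (z : Config E) : Prop where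
  split : ∀ e, zF F z e = true → e ∈ within ends WO ∨ e ∈ within ends WB
  cap : ∀ t, t ∈ WO → t ∈ WB → t = a₁ ∨ t = b
  noloop : ∀ e ∈ F, ¬ (e ∈ within ends WO ∧ e ∈ within ends WB)
  oO : o ∈ WO
  a1O : a₁ ∈ WO
  a1B : a₁ ∈ WB
  bO : b ∈ WO
  bB : b ∈ WB
  a2B : a₂ ∈ WB
  a3B : a₃ ∈ WB
  o1 : o ≠ a₁
  ob : o ≠ b
  a21 : a₂ ≠ a₁
  a2b : a₂ ≠ b
  a31 : a₃ ≠ a₁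
  a3b : a₃ ≠ b

variable {ends o a₁ a₂ a₃ b}
variable {WO WB : Set V} {F : Finset E} {z : Config E}

omit [Fintype E] in
/-- A configuration below `z ∪ F` has its open edges within a side. -/
lemma split_of_le (h : SplitH ends o a₁ a₂ a₃ b WO WB F z) {x : Config E} (hx : x ≤ zF F z) :
    ∀ e, x e = true → e ∈ within ends WO ∨ e ∈ within ends WB := fun e he =>
  h.split e (by have := hx e; rw [he] at this; exact Bool.eq_true_of_true_le this)

/-! ### The seven coordinates -/

section Coords

variable (h : SplitH ends o a₁ a₂ a₃ b WO WB F z) {x : Config E}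
  (hsp : ∀ e, x e = true → e ∈ within ends WO ∨ e ∈ within ends WB)

omit [Fintype E] [DecidableEq E] in
include hsp in
/-- The split with the roles of the sides exchanged. -/
lemma hsp' : ∀ e, x e = true → e ∈ within ends WB ∨ e ∈ within ends WO := fun e he =>
  (hsp e he).symm

omit [Fintype E] in
include h in
/-- The doors from the far side. -/
lemma cap' : ∀ t, t ∈ WB → t ∈ WO → t = a₁ ∨ t = b := fun t h1 h2 => h.cap t h2 h1

omit [Fintype E] in
include h hsp in
/-- `a₁ ~ b = X ∨ b₁`. -/
lemma conn_a1b : Conn ends x a₁ b ↔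
    Conn ends (withinRestr ends WO x) a₁ b ∨ Conn ends (withinRestr ends WB x) a₁ b :=
  conn_doors ends hsp h.cap h.a1O h.a1B

omit [Fintype E] in
include h hsp in
/-- `a₂ ~ a₁ = h₁₂ ∨ (D ∧ b₂)`. -/
lemma conn_a2a1 : Conn ends x a₂ a₁ ↔
    Conn ends (withinRestr ends WB x) a₂ a₁ ∨
      ((Conn ends (withinRestr ends WO x) a₁ b ∨ Conn ends (withinRestr ends WB x) a₁ b) ∧
        Conn ends (withinRestr ends WB x) a₂ b) := by
  have hin := conn_inside ends (hsp' hsp) (cap' h) h.a1B h.a1O h.bB h.bO h.a2B h.a1B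
  rw [conn_a1b h hsp] at hin
  rw [hin]
  constructor
  · rintro (hc | ⟨hD, ⟨h21, _⟩ | ⟨h2b, _⟩⟩)
    · exact Or.inl hc
    · exact Or.inl h21
    · exact Or.inr ⟨hD, h2b⟩
  · rintro (hc | ⟨hD, h2b⟩)
    · exact Or.inl hc
    · exact Or.inr ⟨hD, Or.inr ⟨h2b, conn_refl _ _ _⟩⟩

omit [Fintype E] in
include h hsp in
/-- `a₂ ~ b = b₂ ∨ (D ∧ h₁₂)`. -/
lemma conn_a2b : Conn ends x a₂ b ↔
    Conn ends (withinRestr ends WB x) a₂ b ∨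
      ((Conn ends (withinRestr ends WO x) a₁ b ∨ Conn ends (withinRestr ends WB x) a₁ b) ∧
        Conn ends (withinRestr ends WB x) a₂ a₁) := by
  have hin := conn_inside ends (hsp' hsp) (cap' h) h.a1B h.a1O h.bB h.bO h.a2B h.bB
  rw [conn_a1b h hsp] at hin
  rw [hin]
  constructor
  · rintro (hc | ⟨hD, ⟨h21, _⟩ | ⟨h2b, _⟩⟩)
    · exact Or.inl hc
    · exact Or.inr ⟨hD, h21⟩
    · exact Or.inl h2b
  · rintro (hc | ⟨hD, h21⟩)
    · exact Or.inl hc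
    · exact Or.inr ⟨hD, Or.inl ⟨h21, conn_refl _ _ _⟩⟩

omit [Fintype E] in
include h hsp in
/-- `a₁ ~ a₃ = Y ∨ (D ∧ b₃)`. -/
lemma conn_a1a3 : Conn ends x a₁ a₃ ↔
    Conn ends (withinRestr ends WB x) a₁ a₃ ∨
      ((Conn ends (withinRestr ends WO x) a₁ b ∨ Conn ends (withinRestr ends WB x) a₁ b) ∧
        Conn ends (withinRestr ends WB x) a₃ b) := by
  have hin := conn_inside ends (hsp' hsp) (cap' h) h.a1B h.a1O h.bB h.bO h.a1B h.a3B
  rw [conn_a1b h hsp] at hin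
  rw [hin]
  constructor
  · rintro (hc | ⟨hD, ⟨_, hb3⟩ | ⟨_, h13⟩⟩)
    · exact Or.inl hc
    · exact Or.inr ⟨hD, conn_symm hb3⟩
    · exact Or.inl h13
  · rintro (hc | ⟨hD, h3b⟩)
    · exact Or.inl hc
    · exact Or.inr ⟨hD, Or.inl ⟨conn_refl _ _ _, conn_symm h3b⟩⟩

omit [Fintype E] in
include h hsp in
/-- `a₂ ~ a₃ = h₃₂ ∨ (D ∧ ((h₁₂ ∧ b₃) ∨ (b₂ ∧ Y)))`. -/
lemma conn_a2a3 : Conn ends x a₂ a₃ ↔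
    Conn ends (withinRestr ends WB x) a₂ a₃ ∨
      ((Conn ends (withinRestr ends WO x) a₁ b ∨ Conn ends (withinRestr ends WB x) a₁ b) ∧
        ((Conn ends (withinRestr ends WB x) a₂ a₁ ∧ Conn ends (withinRestr ends WB x) a₃ b) ∨
          (Conn ends (withinRestr ends WB x) a₂ b ∧ Conn ends (withinRestr ends WB x) a₁ a₃))) := by
  have hin := conn_inside ends (hsp' hsp) (cap' h) h.a1B h.a1O h.bB h.bO h.a2B h.a3B
  rw [conn_a1b h hsp] at hin
  rw [hin]
  constructor
  · rintro (hc | ⟨hD, ⟨h21, hb3⟩ | ⟨h2b, h13⟩⟩)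
    · exact Or.inl hc
    · exact Or.inr ⟨hD, Or.inl ⟨h21, conn_symm hb3⟩⟩
    · exact Or.inr ⟨hD, Or.inr ⟨h2b, h13⟩⟩
  · rintro (hc | ⟨hD, ⟨h21, h3b⟩ | ⟨h2b, h13⟩⟩)
    · exact Or.inl hc
    · exact Or.inr ⟨hD, Or.inl ⟨h21, conn_symm h3b⟩⟩
    · exact Or.inr ⟨hD, Or.inr ⟨h2b, h13⟩⟩

omit [Fintype E] in
include h hsp in
/-- `a₁ ~ o = p₁ ∨ (D ∧ p_b)`. -/
lemma conn_a1o : Conn ends x a₁ o ↔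
    Conn ends (withinRestr ends WO x) a₁ o ∨
      ((Conn ends (withinRestr ends WO x) a₁ b ∨ Conn ends (withinRestr ends WB x) a₁ b) ∧
        Conn ends (withinRestr ends WO x) b o) := by
  have hin := conn_inside ends hsp h.cap h.a1O h.a1B h.bO h.bB h.a1O h.oO
  rw [conn_a1b h hsp] at hin
  rw [hin]
  constructor
  · rintro (hc | ⟨hD, ⟨_, hbo⟩ | ⟨_, h1o⟩⟩)
    · exact Or.inl hc
    · exact Or.inr ⟨hD, hbo⟩
    · exact Or.inl h1o
  · rintro (hc | ⟨hD, hbo⟩)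
    · exact Or.inl hc
    · exact Or.inr ⟨hD, Or.inl ⟨conn_refl _ _ _, hbo⟩⟩

omit [Fintype E] in
include h hsp in
/-- `b ~ o = p_b ∨ (D ∧ p₁)`. -/
lemma conn_bo : Conn ends x b o ↔
    Conn ends (withinRestr ends WO x) b o ∨
      ((Conn ends (withinRestr ends WO x) a₁ b ∨ Conn ends (withinRestr ends WB x) a₁ b) ∧
        Conn ends (withinRestr ends WO x) a₁ o) := by
  have hin := conn_inside ends hsp h.cap h.a1O h.a1B h.bO h.bB h.bO h.oO
  rw [conn_a1b h hsp] at hin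
  rw [hin]
  constructor
  · rintro (hc | ⟨hD, ⟨_, hbo⟩ | ⟨_, h1o⟩⟩)
    · exact Or.inl hc
    · exact Or.inl hbo
    · exact Or.inr ⟨hD, h1o⟩
  · rintro (hc | ⟨hD, h1o⟩)
    · exact Or.inl hc
    · exact Or.inr ⟨hD, Or.inr ⟨conn_refl _ _ _, h1o⟩⟩

omit [Fintype E] in
include h hsp in
/-- `a₂ ~ o` through a door: `(a₂~a₁ ∧ a₁~o) ∨ (a₂~b ∧ b~o)`. -/
lemma conn_a2o : Conn ends x a₂ o ↔
    (Conn ends x a₂ a₁ ∧ Conn ends x a₁ o) ∨ (Conn ends x a₂ b ∧ Conn ends x b o) := by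
  have hoB : o ∉ WB := fun hoB => by
    rcases h.cap o h.oO hoB with h1 | hb
    · exact h.o1 h1
    · exact h.ob hb
  constructor
  · intro hc
    exact conn_door ends (hsp' hsp) (cap' h) h.a2B hoB hc
  · rintro (⟨h21, h1o⟩ | ⟨h2b, hbo⟩)
    · exact conn_trans h21 h1o
    · exact conn_trans h2b hbo

end Coords

omit [Fintype E] in
/-- **The state of a copy of the support is the gluing of its side states.** -/
theorem st_eq_harrisSt (h : SplitH ends o a₁ a₂ a₃ b WO WB F z) {x : Config E}
    (hx : x ≤ zF F z) :
    st ends o a₁ a₂ a₃ b x =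
      gluedH (PocketAB.oStP ends o a₁ b WO x) (bSt ends a₁ a₂ a₃ b WB x) := by
  have hsp := split_of_le h hx
  have e1 := conn_a2a1 h hsp
  have e2 := conn_a1o h hsp
  have e3 := conn_a2o h hsp
  have e4 := conn_a1b h hsp
  have e5 := conn_a2b h hsp
  have e6 := conn_a1a3 h hsp
  have e7 := conn_a2a3 h hsp
  have e9 := conn_bo h hsp
  rw [e1, e2, e5, e9] at e3
  unfold st gluedH PocketAB.oStP bSt
  rw [decide_eq_decide.mpr e1, decide_eq_decide.mpr e2, decide_eq_decide.mpr e3,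
    decide_eq_decide.mpr e4, decide_eq_decide.mpr e5, decide_eq_decide.mpr e6,
    decide_eq_decide.mpr e7]
  simp only [Bool.decide_or, Bool.decide_and]
  all_goals infer_instance

end Support

end PocketA1B

end CovForm

end Summit.Ventures.PercRepro2
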